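import Summits.NavierStokesRegularity.NavierStokesRegularity.Theorems.SwirlFreeBudgetEtaMoserCore
import Summits.NavierStokesRegularity.NavierStokesRegularity.Theorems.SwirlFreeBudgetEtaMoserAlgebra
import Summits.NavierStokesRegularity.NavierStokesRegularity.Theorems.SwirlFreeBudgetRegularRepr
import HarnessLib

/-!
# SwirlFreeBudget, crux K-18.1 `EtaMoserBound` REDUCED to the reverse Hölder step for `η`
# (T-18.2: memo Appendix A.5–A.9 are tree theorems; A.2–A.4 remain) (seat nsreg-p4 g12)

Support file for the DORMANT route `SwirlThreshold` (crux stmt-NavierStokesRegularity-2002) and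
planner nsreg-p2's ROUND-18 (`…Theorems.SwirlFreeBudget`, Appendix `R18-APPENDIX-EtaMoser.md`).
**`etaMoserBound_of_etaReverseHolder`: the η-Moser lemma `EtaMoserBound` (K-18.1) follows from the
REVERSE HÖLDER STEP (memo A.5 = CTZ22 (eqA.6) with `Γ ↦ η`)** — for the Seregin–Zajączkowski class
on an axis-centred `Q(z₀, R)` with `V` axisymmetric and swirl free at every point, on every strictly
interior axis-centred sub-cylinder `Q((t₁,x₀), R₂)` with `A((t₁,x₀),R₂) ≤ A₂`:
`‖η‖_{L^{10m/3}(Q_ϱ)} ≤ (N(1+A₂)ϱ'/(ϱ'-ϱ)²)^{1/m} ‖η‖_{L^{2m}(Q_ϱ')}` for `m ≥ 1`,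
`R₂/2 ≤ ϱ < ϱ' ≤ R₂` (`η = angVortQuot`).  Everything downstream of A.5 is now kernel-checked:
Moser's chain (`…MoserChain`), the `p = 2/3` absorption (`…MoserAbsorb`, `…MoserStart(Inner)`),
the start norm from the enstrophy through the certified axis kernel (`…EtaStartNorm`), the a-priori
boundedness and continuity of `η` (`…EtaLocal`), the sub-cylinder gauges (`…GaugeMonotone`), the
assembly on sub-cylinders (`…EtaMoserCore`), the exponent count (`…EtaMoserAlgebra`), and here the
globalisation of `V` by zero outside the cylinder (so that the hypothesis may assume global
symmetry) and the exhaustion A.7 with the fixed sub-cylinder `R₂ = 5R/6`, inner radius `5R/8 ⊇ B(x₀,R/2)`,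
top time `t₁` between `max(t, t₀ - 11R²/36)` and `min(t₀, t + 25R²/64)`.

With T-18.5 (`swirlFreePolynomialBound_of_etaMoserBound`, tree) the swirl-free rung `P₀`/`N₀^{full}`
of R17/R18 therefore rests on the reverse Hölder step ALONE — the localised `L^{2m}` energy
inequality for `∂ₜη + b·∇η = Δη + (2/r)∂ᵣη` with the good-sign axis term (memo A.2–A.4), the exact
analogue of Seregin's (2.5) which the tree proved for the swirl `Γ`
(`…Seregin2020TypeIIMoser*`, `Literature/…/Seregin2020SwirlMoser*`).

WHAT THIS IS NOT: not NS regularity — a CONDITIONAL reduction; the reverse Hölder step and hence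
`EtaMoserBound`, `SwirlFreePolynomialBound` stay OPEN; the with-swirl budget and all hard cores
untouched; no crux claim.
-/

namespace Summit.NavierStokesRegularity.NavierStokesRegularity.Theorems.SwirlFreeBudget

open MeasureTheory Set Filter Topology Metric Function TopologicalSpace
open scoped ENNReal NNReal
open Literature.Analysis Literature.Analysis.FluidPDE
open Literature.Analysis.FluidPDE.SereginZajaczkowski2007

noncomputable section

/-- **The globalisation by zero of the Seregin–Zajączkowski representative.**  For `(V, P)` in the
class on the axis-centred `Q(z₀, R)` with `swirl V = 0` there, the field
`W = 𝟙_{Q(z₀,R)} V` is in the class, axisymmetric and swirl free at EVERY point, agrees with `V` on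
the cylinder, and has the same `η`, `A(z₀,R)` and `E(z₀,R)`. -/
theorem globalise_indicator {V : ℝ → EuclideanSpace ℝ (Fin 3) → EuclideanSpace ℝ (Fin 3)}
    {P : ℝ → EuclideanSpace ℝ (Fin 3) → ℝ} {z₀ : ℝ × EuclideanSpace ℝ (Fin 3)} {R : ℝ}
    (haxis : cylRadius z₀.2 = 0)
    (hsm : IsSmoothAxisymmetricSolutionOn (parabolicCylinderOpens R z₀) V P)
    (hsw : ∀ z ∈ parabolicCylinder R z₀, swirl (V z.1) z.2 = 0) :
    IsSmoothAxisymmetricSolutionOn (parabolicCylinderOpens R z₀)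
        (fun t y => (parabolicCylinder R z₀).indicator (uncurry V) (t, y)) P ∧
      (∀ t, IsAxisymmetric (fun y => (parabolicCylinder R z₀).indicator (uncurry V) (t, y))) ∧
      (∀ t, HasNoSwirl (fun y => (parabolicCylinder R z₀).indicator (uncurry V) (t, y))) ∧
      (∀ z ∈ parabolicCylinder R z₀,
        angVortQuot (fun y => (parabolicCylinder R z₀).indicator (uncurry V) (z.1, y)) z.2 =
          angVortQuot (V z.1) z.2) ∧
      cknA R z₀ (fun t y => (parabolicCylinder R z₀).indicator (uncurry V) (t, y)) = cknA R z₀ V ∧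
      cknE R z₀ (fun t x => fderiv ℝ (fun y => (parabolicCylinder R z₀).indicator (uncurry V) (t, y)) x) =
        cknE R z₀ (fun t x => fderiv ℝ (V t) x) := by
  set Q : Set (ℝ × EuclideanSpace ℝ (Fin 3)) := parabolicCylinder R z₀ with hQ
  set W : ℝ → EuclideanSpace ℝ (Fin 3) → EuclideanSpace ℝ (Fin 3) :=
    fun t y => Q.indicator (uncurry V) (t, y) with hW
  have hQopen : IsOpen Q := isOpen_parabolicCylinder R z₀
  have hSrot : ∀ θ : ℝ, ∀ z ∈ ((parabolicCylinderOpens R z₀ : Opens (ℝ × EuclideanSpace ℝ (Fin 3))) :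
      Set (ℝ × EuclideanSpace ℝ (Fin 3))),
      ((z.1, rotZ θ z.2) : ℝ × EuclideanSpace ℝ (Fin 3)) ∈
        ((parabolicCylinderOpens R z₀ : Opens (ℝ × EuclideanSpace ℝ (Fin 3))) :
          Set (ℝ × EuclideanSpace ℝ (Fin 3))) :=
    fun θ z hz => rotZ_mem_parabolicCylinder_of_axis haxis θ hz
  have hcls : IsSmoothAxisymmetricSolutionOn (parabolicCylinderOpens R z₀) W P :=
    isSmoothAxisymmetricSolutionOn_indicator hsm hSrot
  have hWin : ∀ z ∈ Q, W z.1 z.2 = V z.1 z.2 := fun z hz => by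
    simp only [hW, indicator_of_mem hz, uncurry]
  have hWout : ∀ z ∉ Q, W z.1 z.2 = 0 := fun z hz => by simp only [hW, indicator_of_notMem hz]
  -- slices agree near every point of the cylinder
  have hslice : ∀ z ∈ Q, W z.1 =ᶠ[𝓝 z.2] V z.1 := by
    intro z hz
    have ho : IsOpen {y : EuclideanSpace ℝ (Fin 3) | ((z.1, y) : ℝ × EuclideanSpace ℝ (Fin 3)) ∈ Q} :=
      hQopen.preimage (Continuous.prodMk_right z.1)
    filter_upwards [ho.mem_nhds (show z.2 ∈ {y | ((z.1, y) : ℝ × EuclideanSpace ℝ (Fin 3)) ∈ Q} from hz)]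
      with y hy
    exact hWin (z.1, y) hy
  have hax : ∀ t, IsAxisymmetric (W t) := by
    intro t θ y
    by_cases hy : ((t, y) : ℝ × EuclideanSpace ℝ (Fin 3)) ∈ Q
    · have h1 := hWin (t, y) hy
      have h2 := hWin (t, rotZ θ y) (hSrot θ (t, y) hy)
      simp only at h1 h2
      rw [h1, h2]
      exact hsm.axisymmetric θ (t, y) hy
    · have hy' : ((t, rotZ θ y) : ℝ × EuclideanSpace ℝ (Fin 3)) ∉ Q := by
        intro h
        have h' := hSrot (-θ) (t, rotZ θ y) h
        simp only at h'
        rw [← rotZ_add, neg_add_cancel, rotZ_zero] at h'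
        exact hy h'
      have h1 := hWout (t, y) hy
      have h2 := hWout (t, rotZ θ y) hy'
      simp only at h1 h2
      rw [h1, h2, ← rotZL_apply, map_zero]
  have hns : ∀ t, HasNoSwirl (W t) := by
    intro t y
    by_cases hy : ((t, y) : ℝ × EuclideanSpace ℝ (Fin 3)) ∈ Q
    · have h1 := hWin (t, y) hy
      simp only at h1
      have h0 := hsw (t, y) hy
      simp only [swirl] at h0 ⊢
      rw [h1]
      exact h0
    · have h1 := hWout (t, y) hy
      simp only at h1
      simp only [swirl, h1, PiLp.zero_apply, mul_zero, sub_zero]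
  -- the same `η` on the cylinder
  have hcurl : ∀ z ∈ Q, curl (W z.1) z.2 = curl (V z.1) z.2 := fun z hz =>
    curl_congr_of_eventuallyEq (hslice z hz)
  have hη : ∀ z ∈ Q, angVortQuot (W z.1) z.2 = angVortQuot (V z.1) z.2 := by
    intro z hz
    have hz' := mem_parabolicCylinder.1 hz
    have heq : EqOn (swirl (curl (W z.1))) (swirl (curl (V z.1))) (ball z₀.2 R) := by
      intro y hy
      have hmem : ((z.1, y) : ℝ × EuclideanSpace ℝ (Fin 3)) ∈ Q := by
        rw [hQ, mem_parabolicCylinder]; exact ⟨hz'.1, mem_ball.1 hy⟩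
      simp only [swirl, hcurl (z.1, y) hmem]
    unfold angVortQuot
    exact radQuot_congr_of_eqOn_ball haxis heq (mem_ball.2 hz'.2)
  -- the same gauges
  have hA : cknA R z₀ W = cknA R z₀ V := by
    unfold cknA
    refine iSup_congr fun t => iSup_congr fun ht => ?_
    congr 1
    refine setLIntegral_congr_fun measurableSet_ball fun x hx => ?_
    have hmem : ((t, x) : ℝ × EuclideanSpace ℝ (Fin 3)) ∈ Q := by
      rw [hQ, mem_parabolicCylinder]; exact ⟨ht, mem_ball.1 hx⟩
    have e := hWin (t, x) hmem
    simp only at e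
    rw [e]
  have hE : cknE R z₀ (fun t x => fderiv ℝ (W t) x) = cknE R z₀ (fun t x => fderiv ℝ (V t) x) := by
    unfold cknE
    congr 1
    refine setLIntegral_congr_fun hQopen.measurableSet fun q hq => ?_
    simp only [(hslice q hq).fderiv_eq]
  exact ⟨hcls, hax, hns, hη, hA, hE⟩

/-- **The top time of the exhaustion step** (memo A.7): for `(t, x) ∈ Q(z₀, R/2)` a time `t₁` with
`t < t₁ < t₀`, `t₁ - (5R/8)² < t` and `t₀ - R² < t₁ - (5R/6)²`. -/
theorem exists_exhaustion_time {t₀ t R : ℝ} (hR : 0 < R) (h1 : t₀ - (R / 2) ^ 2 < t) (h2 : t < t₀) :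
    ∃ t₁ : ℝ, t < t₁ ∧ t₁ < t₀ ∧ t₁ - (3 * (5 * R / 6) / 4) ^ 2 < t ∧ t₀ - R ^ 2 < t₁ - (5 * R / 6) ^ 2 := by
  have hR2 : 0 < R ^ 2 := by positivity
  have hLU : max t (t₀ - 11 * R ^ 2 / 36) < min t₀ (t + 25 * R ^ 2 / 64) :=
    max_lt (lt_min h2 (by linarith)) (lt_min (by linarith) (by nlinarith))
  refine ⟨(max t (t₀ - 11 * R ^ 2 / 36) + min t₀ (t + 25 * R ^ 2 / 64)) / 2, ?_, ?_, ?_, ?_⟩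
  · linarith [le_max_left t (t₀ - 11 * R ^ 2 / 36)]
  · linarith [min_le_left t₀ (t + 25 * R ^ 2 / 64)]
  · have := min_le_right t₀ (t + 25 * R ^ 2 / 64)
    nlinarith [le_max_left t (t₀ - 11 * R ^ 2 / 36)]
  · have := le_max_right t (t₀ - 11 * R ^ 2 / 36)
    nlinarith [min_le_left t₀ (t + 25 * R ^ 2 / 64)]

/-- **K-18.1 REDUCED: the reverse Hölder step for `η` implies `EtaMoserBound`.** -/
theorem etaMoserBound_of_etaReverseHolder
    (H : ∃ N : ℝ, 0 < N ∧
      ∀ (V : ℝ → EuclideanSpace ℝ (Fin 3) → EuclideanSpace ℝ (Fin 3))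
        (P : ℝ → EuclideanSpace ℝ (Fin 3) → ℝ) (z₀ : ℝ × EuclideanSpace ℝ (Fin 3)) (R : ℝ),
        0 < R → cylRadius z₀.2 = 0 →
        IsSmoothAxisymmetricSolutionOn (parabolicCylinderOpens R z₀) V P →
        (∀ t, IsAxisymmetric (V t)) → (∀ t, HasNoSwirl (V t)) →
        ∀ (t₁ R₂ : ℝ), 0 < R₂ → R₂ < R → t₁ < z₀.1 → z₀.1 - R ^ 2 < t₁ - R₂ ^ 2 →
        ∀ A₂ : ℝ, 0 ≤ A₂ →
        cknA R₂ ((t₁, z₀.2) : ℝ × EuclideanSpace ℝ (Fin 3)) V ≤ ENNReal.ofReal A₂ →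
        ∀ m : ℝ, 1 ≤ m → ∀ ϱ ϱ' : ℝ, R₂ / 2 ≤ ϱ → ϱ < ϱ' → ϱ' ≤ R₂ →
          eLpNorm (fun w : ℝ × EuclideanSpace ℝ (Fin 3) => angVortQuot (V w.1) w.2)
              (ENNReal.ofReal (10 * m / 3))
              (volume.restrict (parabolicCylinder ϱ ((t₁, z₀.2) : ℝ × EuclideanSpace ℝ (Fin 3)))) ≤
            ENNReal.ofReal (N * (1 + A₂) * ϱ' / (ϱ' - ϱ) ^ 2) ^ (1 / m) *
              eLpNorm (fun w : ℝ × EuclideanSpace ℝ (Fin 3) => angVortQuot (V w.1) w.2)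
                (ENNReal.ofReal (2 * m))
                (volume.restrict (parabolicCylinder ϱ' ((t₁, z₀.2) : ℝ × EuclideanSpace ℝ (Fin 3))))) :
    EtaMoserBound := by
  obtain ⟨N, hN, hRH⟩ := H
  obtain ⟨c, hc, hcore⟩ := exists_abs_angVortQuot_le_sub
  obtain ⟨K, hK, halg⟩ := exists_coreBound_le hc hN
  refine ⟨K, hK, ?_⟩
  intro V P z₀ R hR haxis hsm hsw A E hA hE hcknA hcknE z hz
  -- globalise
  obtain ⟨hcls, hax, hns, hη, hAeq, hEeq⟩ := globalise_indicator haxis hsm hsw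
  set W : ℝ → EuclideanSpace ℝ (Fin 3) → EuclideanSpace ℝ (Fin 3) :=
    fun t y => (parabolicCylinder R z₀).indicator (uncurry V) (t, y) with hW
  have hcknA' : cknA R z₀ W ≤ ENNReal.ofReal A := by rw [hAeq]; exact hcknA
  have hcknE' : cknE R z₀ (fun t x => fderiv ℝ (W t) x) ≤ ENNReal.ofReal E := by rw [hEeq]; exact hcknE
  -- the sub-cylinder through `z`
  obtain ⟨⟨ht1, ht2⟩, hxd⟩ := mem_parabolicCylinder.1 hz
  obtain ⟨t₁, htt₁, ht₁, htime, hwin⟩ := exists_exhaustion_time hR ht1 ht2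
  have hzQ : z ∈ parabolicCylinder R z₀ := by
    rw [mem_parabolicCylinder]
    exact ⟨⟨by nlinarith, ht2⟩, hxd.trans (by linarith)⟩
  have hzsub : z ∈ parabolicCylinder (3 * (5 * R / 6) / 4) ((t₁, z₀.2) : ℝ × EuclideanSpace ℝ (Fin 3)) := by
    rw [mem_parabolicCylinder]
    exact ⟨⟨htime, htt₁⟩, hxd.trans (by linarith)⟩
  have key := hcore N hN hRH W P z₀ R hR haxis hcls hax hns t₁ (5 * R / 6) (by positivity) (by linarith)
    ht₁ hwin A E hA hE hcknA' hcknE' z hzsub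
  have e := hη z hzQ
  rw [e] at key
  exact key.trans (halg A E R hA hE hR)

end

end Summit.NavierStokesRegularity.NavierStokesRegularity.Theorems.SwirlFreeBudget
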